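import Summits.HodgeConjecture.HodgeConjecture.Theorems.R90S6BCPartnerRecursion     -- ★ W10-g (H.3)(H.4): `bcGraphPartnerAlgHom_cartan_mul_heckeDiag_one∕_two`, `_cartan_add_one` (brings ★ W10-c (B.2))
import Summits.HodgeConjecture.HodgeConjecture.Theorems.R90S6GLThreePieriClosed      -- ★ W10-f closed sequel: `exists_eq_add_single_of_ncard_pieri_one_ne_zero`∕`…_two_…` (brings ★ L3 tables)
import HarnessLib

/-!
# R90 · S6 «Ch. 14.1–14.5 stable TF» — card W10-h (h.1′)+API, FILE A: THE `b`-RECURSION ON THE TWO-PARAMETER FAMILY `B_{a,b} = b(c_{(a,b,0)})`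
# (`Theorems/R90S6BCPartnerPairRecursion.lean`; row E1.4.4.2.3, coefficient layer)

Cell `hodgecm-mathlib`, crux H413 (`stmt-HodgeConjecture-24833`), route of record `HCCMUnconditional`; programme R90-TF, section S6 (base `R90-C14`),
seat K2Liu-p27 (g4) (cross-line hand, chair K2-lead VALVE 14, 2026-09-05T01:49:33Z); S6 dealer R90-C14-plan (g2) RE-SCOPE of card W10-h (R90 bus
01:48:30Z, GO 01:54:52Z): «(i) SHELL∕TOP-COEFFICIENT THEOREM `b(c_{(a,b,0)}) ∈ Φ_a + span_ℂ{Φ_k : k < a}` by induction on `a` over ★ (H.3) + ★ W10-c +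
★ U(3) three-term law, (ii) `bT₃ = 1` central reduction (★), (iii) the recursion restated as the public API with the β-table rows (1,0)…(2,2) as named corollaries».
Lane `--supports stmt-HodgeConjecture-24833 --as helper`; THEOREMS ONLY (no definition, no instance, no notation, no named fact, no `sorry`).
This is FILE A of three (A: the recursion; B `R90S6BCPartnerShell`: the shell ∕ top-coefficient theorem; C `R90S6BCPartnerShellRows`: the rows of the β-table).

LETTERS (`GL₃` side, VERBATIM as ★ W10-c∕W10-g): generic DVR field `K` (`hϖ`, `hu : u² = q`, `hwt`), `q = #𝓀[K]`, `c_ν := 1_{K₀ ϖ^ν K₀} =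
doubleCosetOperator (glInt 3 K) (zpowDiagGL ν)`, `T₁ = 1_{K₀ diag(ϖ,1,1) K₀}`, `b := bcGraphPartnerAlgHom …` (print's `ψ̂_G`), `B_ν := b(c_ν)`, and the two-parameter
family `B_{a,b} := B_{(a,b,0)}`, written `![(a : ℤ), (b : ℤ), 0]` with `a b : ℕ` (`B_ν` only depends on `ν` mod `𝟙`, ★ (H.4.c)).

WHAT IS PROVED (★ (H.3) `bcGraphPartnerAlgHom_cartan_mul_heckeDiag_one∕_two` at `μ = (a,b,0)` ∕ `(a,a,0)`, support binders discharged by ★ p864298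
`exists_eq_add_single_of_ncard_pieri_one_ne_zero`∕`exists_eq_add_one_sub_single_of_ncard_pieri_two_ne_zero`, the strip counts by p10's ★ closed forms
`ncard_pieri_one_add_single_zero∕_one∕_two`, `ncard_pieri_two_add_single_zero_one∕_zero_two`, the `e₂`-strips folded by the central collapse ★ `bcGraphPartnerAlgHom_cartan_add_one`,
`bT₂ = bT₁` ★ (B.2)); both identities are ADDITIVE (`B·bT₁ = Σ`), solving for the new top term is one cancellation:
* **`bcGraphPartnerAlgHom_cartan_pair_mul_heckeDiag_one`** (R1): for `b ≤ a`,
  `B_{a,b}·bT₁ = B_{a+1,b} + [b+1 ≤ a]·(q + [a = b+1]) • B_{a,b+1} + [1 ≤ b]·(q² + [b = 1]q + [a = b = 1]) • B_{a−1,b−1}`;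
* **`bcGraphPartnerAlgHom_cartan_diag_mul_heckeDiag_one`** (R2): `B_{a,a}·bT₁ = [1 ≤ a]·(q + [a = 1]) • B_{a,a−1} + B_{a+1,a+1}`.
ENGINEERING NOTE (for the next hand on these carriers).  Inside `ℋ(U(3)_w, K₀)`-valued hypotheses every rewrite is a `simp only` (reducible matching):
`rw … at h`, `congr`, `subst` compare the Pieri-strip `Antitone` conditions or the `SetLike` instance chains at default transparency and time out (cf. ★ W10-c);
the carrier has no usable `−` (its `Sub` is `AddSubgroupClass.sub`), so everything is stated additively.
HONEST LABEL: local Hecke bookkeeping for E1.4.4.2.3, count-neutral until the BC identity consumes it; HC_CM is proved only modulo the 7 printed citations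
(2 remaining named inputs: hLiu418 = stmt-HodgeConjecture-24832, h413 = stmt-HodgeConjecture-24833) until rung 0 closes; REL ≠ ★ ≠ BUILT.

## References
* [Rogawski1990] J. D. Rogawski, *Automorphic Representations of Unitary Groups in Three Variables*, Ann. of Math. Stud. 123 (1990), §4.10 Prop. 4.10.2 p. 58.
* [Macdonald1995] I. G. Macdonald, *Symmetric Functions and Hall Polynomials*, 2nd ed. (1995), Ch. II (4.6), Ch. V (2.5)–(2.6).
* [Macdonald1971] I. G. Macdonald, *Spherical functions on a group of p-adic type* (1971), Ch. V §3.
* [CartierCorvallis1979] P. Cartier, *Representations of 𝔭-adic groups: a survey*, PSPM 33.1 (1979), §IV (4.2), Thm. 4.1, Cor. 4.2.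
-/

set_option autoImplicit false
-- the mandated namespace repeats the single-problem summit's segment (`HodgeConjecture.HodgeConjecture`)
set_option linter.dupNamespace false

noncomputable section

open MulAction
open NumberField IsDedekindDomain
open Literature.NumberTheory.Automorphic Literature.NumberTheory.Automorphic.HermitianLattice Literature.NumberTheory.Automorphic.UnitaryGroup
open Literature.NumberTheory.Automorphic.CartanUnique
open scoped MatrixGroups
open ValuativeRel

namespace Summit.HodgeConjecture.HodgeConjecture.R90.S6

universe u

/-! ## §1 Exponent-vector bookkeeping and the strip counts at `μ = (a,b,0)` -/

section Vectors

/-- Antitonicity of an explicit exponent vector `(x, y, z)`. [folklore] -/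
private theorem antitone_vec_iff (x y z : ℤ) : Antitone (![x, y, z] : Fin 3 → ℤ) ↔ y ≤ x ∧ z ≤ y := by
  rw [antitone_fin_three_iff]
  simp

/-- `(x,y,z) + e₀ = (x+1,y,z)`. [folklore] -/
private theorem vec_add_single_zero (x y z : ℤ) : (![x, y, z] : Fin 3 → ℤ) + Pi.single 0 1 = ![x + 1, y, z] := by
  funext i; fin_cases i <;> simp

/-- `(x,y,z) + e₁ = (x,y+1,z)`. [folklore] -/
private theorem vec_add_single_one (x y z : ℤ) : (![x, y, z] : Fin 3 → ℤ) + Pi.single 1 1 = ![x, y + 1, z] := by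
  funext i; fin_cases i <;> simp

/-- `(x,y,z) + e₂ = (x,y,z+1)`. [folklore] -/
private theorem vec_add_single_two (x y z : ℤ) : (![x, y, z] : Fin 3 → ℤ) + Pi.single 2 1 = ![x, y, z + 1] := by
  funext i; fin_cases i <;> simp

/-- `(x,y,z) + 𝟙 − e₀ = (x,y+1,z+1)`. [folklore] -/
private theorem vec_add_one_sub_single_zero (x y z : ℤ) : (![x, y, z] : Fin 3 → ℤ) + 1 - Pi.single 0 1 = ![x, y + 1, z + 1] := by
  funext i; simp only [Pi.add_apply, Pi.sub_apply, Pi.one_apply]; fin_cases i <;> simp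

/-- `(x,y,z) + 𝟙 − e₁ = (x+1,y,z+1)`. [folklore] -/
private theorem vec_add_one_sub_single_one (x y z : ℤ) : (![x, y, z] : Fin 3 → ℤ) + 1 - Pi.single 1 1 = ![x + 1, y, z + 1] := by
  funext i; simp only [Pi.add_apply, Pi.sub_apply, Pi.one_apply]; fin_cases i <;> simp

/-- `(x,y,z) + 𝟙 − e₂ = (x+1,y+1,z)`. [folklore] -/
private theorem vec_add_one_sub_single_two (x y z : ℤ) : (![x, y, z] : Fin 3 → ℤ) + 1 - Pi.single 2 1 = ![x + 1, y + 1, z] := by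
  funext i; simp only [Pi.add_apply, Pi.sub_apply, Pi.one_apply]; fin_cases i <;> simp

/-- `(x,y,0) + e₂ = (x−1,y−1,0) + 𝟙` (the `e₂` Pieri term is central-equivalent to `(x−1,y−1,0)`). [folklore] -/
private theorem vec_pair_add_single_two (x y : ℤ) : (![x, y, 0] : Fin 3 → ℤ) + Pi.single 2 1 = ![x - 1, y - 1, 0] + 1 := by
  funext i; simp only [Pi.add_apply, Pi.one_apply]; fin_cases i <;> simp

/-- `(x,x,0) + 𝟙 − e₁ = (x,x−1,0) + 𝟙`. [folklore] -/
private theorem vec_diag_add_one_sub_single_one (x : ℤ) : (![x, x, 0] : Fin 3 → ℤ) + 1 - Pi.single 1 1 = ![x, x - 1, 0] + 1 := by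
  funext i; simp only [Pi.add_apply, Pi.sub_apply, Pi.one_apply]; fin_cases i <;> simp

/-- `μ + 𝟙 − e₁ = μ + e₀ + e₂` (re-indexing the omitted row). [folklore] -/
private theorem vec_add_one_sub_single_one_eq (μ : Fin 3 → ℤ) : μ + 1 - Pi.single 1 1 = μ + Pi.single 0 1 + Pi.single 2 1 := by
  funext i; simp only [Pi.add_apply, Pi.sub_apply, Pi.one_apply]; fin_cases i <;> simp

/-- `μ + 𝟙 − e₂ = μ + e₀ + e₁` (re-indexing the omitted row). [folklore] -/
private theorem vec_add_one_sub_single_two_eq (μ : Fin 3 → ℤ) : μ + 1 - Pi.single 2 1 = μ + Pi.single 0 1 + Pi.single 1 1 := by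
  funext i; simp only [Pi.add_apply, Pi.sub_apply, Pi.one_apply]; fin_cases i <;> simp

end Vectors

section Counts

variable {K : Type u} [Field K] [ValuativeRel K] [IsDiscreteValuationRing 𝒪[K]] [Finite 𝓀[K]] {ϖ : K} (hϖ : IsUniformizingElement ϖ)

/-- `(a,b,0)` is antitone for `b ≤ a`. [folklore] -/
private theorem antitone_pair {a b : ℕ} (hba : b ≤ a) : Antitone (![(a : ℤ), (b : ℤ), 0] : Fin 3 → ℤ) :=
  (antitone_vec_iff _ _ _).2 ⟨by exact_mod_cast hba, by positivity⟩

/-- `N₁((a,b,0), (a,b+1,0)) = q + [a = b+1]` for `b + 1 ≤ a` (★ p10 `ncard_pieri_one_add_single_one`). [cite: Macdonald1995, Ch. II (4.6)] -/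
private theorem ncard_pair_add_single_one {a b : ℕ} (h : b + 1 ≤ a) :
    {γ ∈ MulAction.orbit (glInt 3 K) ((heckeDiag 3 (Units.mk0 ϖ hϖ.ne_zero) 1 : GL (Fin 3) K) : GL (Fin 3) K ⧸ glInt 3 K) |
        ((γ.out⁻¹ * zpowDiagGL hϖ.ne_zero ((![(a : ℤ), (b : ℤ), 0] : Fin 3 → ℤ) + Pi.single 1 1) : GL (Fin 3) K) : GL (Fin 3) K ⧸ glInt 3 K) ∈
          MulAction.orbit (glInt 3 K) ((zpowDiagGL hϖ.ne_zero ![(a : ℤ), (b : ℤ), 0] : GL (Fin 3) K) : _ ⧸ _)}.ncard =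
      Nat.card 𝓀[K] + if a = b + 1 then 1 else 0 := by
  rw [ncard_pieri_one_add_single_one hϖ (antitone_pair (by omega)) (by simp; omega)]
  simp only [Matrix.cons_val_zero, Matrix.cons_val_one]
  split_ifs <;> omega

/-- `N₁((a,b,0), (a,b,1)) = q² + [b = 1]·q + [a = b = 1]` for `1 ≤ b ≤ a` (★ p10 `ncard_pieri_one_add_single_two`). [cite: Macdonald1995, Ch. II (4.6)] -/
private theorem ncard_pair_add_single_two {a b : ℕ} (hba : b ≤ a) (h : 1 ≤ b) :
    {γ ∈ MulAction.orbit (glInt 3 K) ((heckeDiag 3 (Units.mk0 ϖ hϖ.ne_zero) 1 : GL (Fin 3) K) : GL (Fin 3) K ⧸ glInt 3 K) |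
        ((γ.out⁻¹ * zpowDiagGL hϖ.ne_zero ((![(a : ℤ), (b : ℤ), 0] : Fin 3 → ℤ) + Pi.single 2 1) : GL (Fin 3) K) : GL (Fin 3) K ⧸ glInt 3 K) ∈
          MulAction.orbit (glInt 3 K) ((zpowDiagGL hϖ.ne_zero ![(a : ℤ), (b : ℤ), 0] : GL (Fin 3) K) : _ ⧸ _)}.ncard =
      Nat.card 𝓀[K] ^ 2 + (if b = 1 then Nat.card 𝓀[K] else 0) + (if a = b ∧ b = 1 then 1 else 0) := by
  rw [ncard_pieri_one_add_single_two hϖ (antitone_pair hba) (by simp; omega)]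
  simp only [Matrix.cons_val_zero, Matrix.cons_val_one, Matrix.head_cons, Matrix.cons_val_two, Matrix.tail_cons, zero_add]
  split_ifs <;> omega

/-- `N₂((a,a,0), (a+1,a+1,0)) = 1` (★ p10 `ncard_pieri_two_add_single_zero_one`, re-indexed by the omitted row `2`). [cite: Macdonald1995, Ch. II (4.6)] -/
private theorem ncard_diag_add_one_sub_single_two (a : ℕ) :
    {γ ∈ MulAction.orbit (glInt 3 K) ((heckeDiag 3 (Units.mk0 ϖ hϖ.ne_zero) 2 : GL (Fin 3) K) : GL (Fin 3) K ⧸ glInt 3 K) |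
        ((γ.out⁻¹ * zpowDiagGL hϖ.ne_zero ((![(a : ℤ), (a : ℤ), 0] : Fin 3 → ℤ) + 1 - Pi.single 2 1) : GL (Fin 3) K) : GL (Fin 3) K ⧸ glInt 3 K) ∈
          MulAction.orbit (glInt 3 K) ((zpowDiagGL hϖ.ne_zero ![(a : ℤ), (a : ℤ), 0] : GL (Fin 3) K) : _ ⧸ _)}.ncard = 1 := by
  rw [vec_add_one_sub_single_two_eq, ncard_pieri_two_add_single_zero_one hϖ (antitone_pair le_rfl)]

/-- `N₂((a,a,0), (a+1,a,1)) = q + [a = 1]` for `1 ≤ a` (★ p10 `ncard_pieri_two_add_single_zero_two`, re-indexed by the omitted row `1`).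
[cite: Macdonald1995, Ch. II (4.6)] -/
private theorem ncard_diag_add_one_sub_single_one {a : ℕ} (h : 1 ≤ a) :
    {γ ∈ MulAction.orbit (glInt 3 K) ((heckeDiag 3 (Units.mk0 ϖ hϖ.ne_zero) 2 : GL (Fin 3) K) : GL (Fin 3) K ⧸ glInt 3 K) |
        ((γ.out⁻¹ * zpowDiagGL hϖ.ne_zero ((![(a : ℤ), (a : ℤ), 0] : Fin 3 → ℤ) + 1 - Pi.single 1 1) : GL (Fin 3) K) : GL (Fin 3) K ⧸ glInt 3 K) ∈
          MulAction.orbit (glInt 3 K) ((zpowDiagGL hϖ.ne_zero ![(a : ℤ), (a : ℤ), 0] : GL (Fin 3) K) : _ ⧸ _)}.ncard =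
      Nat.card 𝓀[K] + if a = 1 then 1 else 0 := by
  rw [vec_add_one_sub_single_one_eq, ncard_pieri_two_add_single_zero_two hϖ (antitone_pair le_rfl) (by simp; omega)]
  simp only [Matrix.cons_val_zero, Matrix.cons_val_one, Matrix.head_cons, Matrix.cons_val_two, Matrix.tail_cons, zero_add]
  split_ifs <;> omega

end Counts

section Recursion

variable {F E : Type} [Field F] [NumberField F] [Field E] [NumberField E] [Algebra F E] [Algebra.IsQuadraticExtension F E]
  (c : E ≃ₐ[F] E) (hc1 : c ≠ 1) (v : HeightOneSpectrum (𝓞 F)) (w : PlacesOver E v) (hw : c • w.1 = w.1)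
  (hv : Algebra.IsUnramifiedIn (𝓞 E) v.asIdeal)
  {K : Type u} [Field K] [ValuativeRel K] [IsDiscreteValuationRing 𝒪[K]] [Finite 𝓀[K]] {ϖ : K}
  [IsHeckeTriple (⊤ : Submonoid (GL (Fin 3) K)) (glInt 3 K) (glInt 3 K)]
  (hϖ : IsUniformizingElement ϖ) {u : ℂˣ} (hu : (u : ℂ) ^ 2 = ((Nat.card 𝓀[K] : ℕ) : ℂ))
  {wt : Multiplicative (Fin 3 → ℤ) →* ℂ}
  (hwt : ∀ e : Fin 3 → ℤ, wt (Multiplicative.ofAdd e) = ((u ^ ((((3 : ℕ) : ℤ) - 1) * (∑ i, e i) - 2 * satakeTwistExp e) : ℂˣ) : ℂ))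

/-- **(R1) THE `b`-RECURSION ON THE TWO-PARAMETER FAMILY, `r = 1`.**  For `b ≤ a` (so `μ = (a,b,0)` is antitone), with `q = #𝓀[K]`:
`B_{a,b} · bT₁ = B_{a+1,b} + [b+1 ≤ a]·(q + [a = b+1]) • B_{a,b+1} + [1 ≤ b]·(q² + [b = 1]·q + [a = b = 1]) • B_{a−1,b−1}` — ★ (H.3)
`bcGraphPartnerAlgHom_cartan_mul_heckeDiag_one` with the support binder discharged by ★ `exists_eq_add_single_of_ncard_pieri_one_ne_zero`, the three
counts by ★ `ncard_pieri_one_add_single_zero∕_one∕_two` (`N₁(μ, μ+e₀) = 1`: the new top term enters with coefficient ONE), and the `e₂` strip `(a,b,1)`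
folded to `B_{a−1,b−1}` by the central collapse ★ `bcGraphPartnerAlgHom_cartan_add_one`.  Solving for `B_{a+1,b}` is the linear recursion of the card.
[cite: Rogawski1990, §4.10 Prop. 4.10.2 p. 58] [cite: Macdonald1995, Ch. II (4.6), Ch. V (2.5)–(2.6)] -/
theorem bcGraphPartnerAlgHom_cartan_pair_mul_heckeDiag_one {a b : ℕ} (hba : b ≤ a) :
    bcGraphPartnerAlgHom c hc1 v w hw hv hϖ hu hwt
          (heckeAlgebra.doubleCosetOperator (glInt 3 K) (zpowDiagGL hϖ.ne_zero ![(a : ℤ), (b : ℤ), 0])) *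
        bcGraphPartnerAlgHom c hc1 v w hw hv hϖ hu hwt
          (heckeAlgebra.doubleCosetOperator (glInt 3 K) (heckeDiag 3 (Units.mk0 ϖ hϖ.ne_zero) 1)) =
      bcGraphPartnerAlgHom c hc1 v w hw hv hϖ hu hwt
          (heckeAlgebra.doubleCosetOperator (glInt 3 K) (zpowDiagGL hϖ.ne_zero ![(a : ℤ) + 1, (b : ℤ), 0])) +
        (if b + 1 ≤ a then (((Nat.card 𝓀[K] + if a = b + 1 then 1 else 0 : ℕ) : ℂ)) else 0) •
          bcGraphPartnerAlgHom c hc1 v w hw hv hϖ hu hwt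
            (heckeAlgebra.doubleCosetOperator (glInt 3 K) (zpowDiagGL hϖ.ne_zero ![(a : ℤ), (b : ℤ) + 1, 0])) +
        (if 1 ≤ b then
            (((Nat.card 𝓀[K] ^ 2 + (if b = 1 then Nat.card 𝓀[K] else 0) + (if a = b ∧ b = 1 then 1 else 0) : ℕ) : ℂ))
          else 0) •
          bcGraphPartnerAlgHom c hc1 v w hw hv hϖ hu hwt
            (heckeAlgebra.doubleCosetOperator (glInt 3 K) (zpowDiagGL hϖ.ne_zero ![(a : ℤ) - 1, (b : ℤ) - 1, 0])) := by
  have hμ : Antitone (![(a : ℤ), (b : ℤ), 0] : Fin 3 → ℤ) := antitone_pair hba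
  have h := bcGraphPartnerAlgHom_cartan_mul_heckeDiag_one c hc1 v w hw hv hϖ hu hwt ![(a : ℤ), (b : ℤ), 0]
    (exists_eq_add_single_of_ncard_pieri_one_ne_zero hϖ hμ)
  have hA0 : Antitone ((![(a : ℤ), (b : ℤ), 0] : Fin 3 → ℤ) + Pi.single 0 1) := by
    rw [vec_add_single_zero]; exact (antitone_vec_iff _ _ _).2 ⟨by omega, by omega⟩
  -- every rewrite inside the heavy carriers is done by `simp only` (reducible matching); `rw`∕`congr` compare the Pieri strips or the `SetLike`
  -- instance paths at default transparency and time out (cf. ★ W10-c's hygiene note)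
  by_cases h1 : b + 1 ≤ a
  · have hA1 : Antitone ((![(a : ℤ), (b : ℤ), 0] : Fin 3 → ℤ) + Pi.single 1 1) := by
      rw [vec_add_single_one]; exact (antitone_vec_iff _ _ _).2 ⟨by omega, by omega⟩
    by_cases h2 : 1 ≤ b
    · have hA2 : Antitone ((![(a : ℤ), (b : ℤ), 0] : Fin 3 → ℤ) + Pi.single 2 1) := by
        rw [vec_add_single_two]; exact (antitone_vec_iff _ _ _).2 ⟨by omega, by omega⟩
      simp only [Finset.sum_filter, Fin.sum_univ_three, if_pos hA0, if_pos hA1, if_pos hA2, ncard_pieri_one_add_single_zero hϖ hμ,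
        ncard_pair_add_single_one hϖ h1, ncard_pair_add_single_two hϖ hba h2, Nat.cast_one, one_smul] at h
      simp only [vec_add_single_zero, vec_add_single_one, vec_pair_add_single_two, bcGraphPartnerAlgHom_cartan_add_one c hc1 v w hw hv hϖ hu hwt] at h
      simp only [if_pos h1, if_pos h2]
      exact h
    · have hA2 : ¬ Antitone ((![(a : ℤ), (b : ℤ), 0] : Fin 3 → ℤ) + Pi.single 2 1) := by
        rw [vec_add_single_two, antitone_vec_iff]; omega
      simp only [Finset.sum_filter, Fin.sum_univ_three, if_pos hA0, if_pos hA1, if_neg hA2, ncard_pieri_one_add_single_zero hϖ hμ,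
        ncard_pair_add_single_one hϖ h1, Nat.cast_one, one_smul, add_zero] at h
      simp only [vec_add_single_zero, vec_add_single_one] at h
      simp only [if_pos h1, if_neg h2, zero_smul, add_zero]
      exact h
  · have hA1 : ¬ Antitone ((![(a : ℤ), (b : ℤ), 0] : Fin 3 → ℤ) + Pi.single 1 1) := by
      rw [vec_add_single_one, antitone_vec_iff]; omega
    by_cases h2 : 1 ≤ b
    · have hA2 : Antitone ((![(a : ℤ), (b : ℤ), 0] : Fin 3 → ℤ) + Pi.single 2 1) := by
        rw [vec_add_single_two]; exact (antitone_vec_iff _ _ _).2 ⟨by omega, by omega⟩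
      simp only [Finset.sum_filter, Fin.sum_univ_three, if_pos hA0, if_neg hA1, if_pos hA2, ncard_pieri_one_add_single_zero hϖ hμ,
        ncard_pair_add_single_two hϖ hba h2, Nat.cast_one, one_smul, add_zero] at h
      simp only [vec_add_single_zero, vec_pair_add_single_two, bcGraphPartnerAlgHom_cartan_add_one c hc1 v w hw hv hϖ hu hwt] at h
      simp only [if_neg h1, if_pos h2, zero_smul, add_zero]
      exact h
    · have hA2 : ¬ Antitone ((![(a : ℤ), (b : ℤ), 0] : Fin 3 → ℤ) + Pi.single 2 1) := by
        rw [vec_add_single_two, antitone_vec_iff]; omega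
      simp only [Finset.sum_filter, Fin.sum_univ_three, if_pos hA0, if_neg hA1, if_neg hA2, ncard_pieri_one_add_single_zero hϖ hμ,
        Nat.cast_one, one_smul, add_zero] at h
      simp only [vec_add_single_zero] at h
      simp only [if_neg h1, if_neg h2, zero_smul, add_zero]
      exact h

/-- **(R2) THE `b`-RECURSION ON THE DIAGONAL, `r = 2`.**  `B_{a,a} · bT₁ = [1 ≤ a]·(q + [a = 1]) • B_{a,a−1} + B_{a+1,a+1}` — ★ (H.3)
`bcGraphPartnerAlgHom_cartan_mul_heckeDiag_two` at `μ = (a,a,0)` (support by ★ `exists_eq_add_one_sub_single_of_ncard_pieri_two_ne_zero`; the strip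
`μ + 𝟙 − e₀ = (a,a+1,1)` is absent, `N₂(μ,(a+1,a+1,0)) = 1` ★ `ncard_pieri_two_add_single_zero_one`, `N₂(μ,(a+1,a,1)) = q + [a = 1]` ★
`ncard_pieri_two_add_single_zero_two`), `bT₂ = bT₁` ★ (B.2), and the central collapse ★ `bcGraphPartnerAlgHom_cartan_add_one` (`(a+1,a,1) ↦ (a,a−1,0)`).
Solving for `B_{a+1,a+1}` closes the induction on `a` on the diagonal `b = a`. [cite: Rogawski1990, §4.10 Prop. 4.10.2 p. 58] [cite: Macdonald1995, Ch. II (4.6), Ch. V (2.5)–(2.6)] -/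
theorem bcGraphPartnerAlgHom_cartan_diag_mul_heckeDiag_one (a : ℕ) :
    bcGraphPartnerAlgHom c hc1 v w hw hv hϖ hu hwt
          (heckeAlgebra.doubleCosetOperator (glInt 3 K) (zpowDiagGL hϖ.ne_zero ![(a : ℤ), (a : ℤ), 0])) *
        bcGraphPartnerAlgHom c hc1 v w hw hv hϖ hu hwt
          (heckeAlgebra.doubleCosetOperator (glInt 3 K) (heckeDiag 3 (Units.mk0 ϖ hϖ.ne_zero) 1)) =
      (if 1 ≤ a then (((Nat.card 𝓀[K] + if a = 1 then 1 else 0 : ℕ) : ℂ)) else 0) •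
          bcGraphPartnerAlgHom c hc1 v w hw hv hϖ hu hwt
            (heckeAlgebra.doubleCosetOperator (glInt 3 K) (zpowDiagGL hϖ.ne_zero ![(a : ℤ), (a : ℤ) - 1, 0])) +
        bcGraphPartnerAlgHom c hc1 v w hw hv hϖ hu hwt
          (heckeAlgebra.doubleCosetOperator (glInt 3 K) (zpowDiagGL hϖ.ne_zero ![(a : ℤ) + 1, (a : ℤ) + 1, 0])) := by
  have hμ : Antitone (![(a : ℤ), (a : ℤ), 0] : Fin 3 → ℤ) := antitone_pair le_rfl
  have h := bcGraphPartnerAlgHom_cartan_mul_heckeDiag_two c hc1 v w hw hv hϖ hu hwt ![(a : ℤ), (a : ℤ), 0]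
    (exists_eq_add_one_sub_single_of_ncard_pieri_two_ne_zero hϖ hμ)
  have hA0 : ¬ Antitone ((![(a : ℤ), (a : ℤ), 0] : Fin 3 → ℤ) + 1 - Pi.single 0 1) := by
    rw [vec_add_one_sub_single_zero, antitone_vec_iff]; omega
  have hA2 : Antitone ((![(a : ℤ), (a : ℤ), 0] : Fin 3 → ℤ) + 1 - Pi.single 2 1) := by
    rw [vec_add_one_sub_single_two]; exact (antitone_vec_iff _ _ _).2 ⟨by omega, by omega⟩
  by_cases h1 : 1 ≤ a
  · have hA1 : Antitone ((![(a : ℤ), (a : ℤ), 0] : Fin 3 → ℤ) + 1 - Pi.single 1 1) := by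
      rw [vec_add_one_sub_single_one]; exact (antitone_vec_iff _ _ _).2 ⟨by omega, by omega⟩
    simp only [Finset.sum_filter, Fin.sum_univ_three, if_neg hA0, if_pos hA1, if_pos hA2, zero_add, ncard_diag_add_one_sub_single_two hϖ,
      ncard_diag_add_one_sub_single_one hϖ h1, Nat.cast_one, one_smul, bcGraphPartnerAlgHom_heckeDiag_two c hc1 v w hw hv hϖ hu hwt] at h
    simp only [vec_add_one_sub_single_two, vec_diag_add_one_sub_single_one, bcGraphPartnerAlgHom_cartan_add_one c hc1 v w hw hv hϖ hu hwt] at h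
    simp only [if_pos h1]
    exact h
  · have hA1 : ¬ Antitone ((![(a : ℤ), (a : ℤ), 0] : Fin 3 → ℤ) + 1 - Pi.single 1 1) := by
      rw [vec_add_one_sub_single_one, antitone_vec_iff]; omega
    simp only [Finset.sum_filter, Fin.sum_univ_three, if_neg hA0, if_neg hA1, if_pos hA2, zero_add, ncard_diag_add_one_sub_single_two hϖ,
      Nat.cast_one, one_smul, bcGraphPartnerAlgHom_heckeDiag_two c hc1 v w hw hv hϖ hu hwt] at h
    simp only [vec_add_one_sub_single_two] at h
    simp only [if_neg h1, zero_smul, zero_add]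
    exact h

end Recursion

end Summit.HodgeConjecture.HodgeConjecture.R90.S6

end
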